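import Summits.BirchSwinnertonDyer.BirchSwinnertonDyer.Theses.SignedBaseChange
import Literature.NumberTheory.EllipticCurves.YanZhu2026.GreenbergMainTheoremsAnyRoot
import Literature.NumberTheory.EllipticCurves.HeegnerPointsKolyvaginTorsionProofs
import HarnessLib

/-! # `ratlift` — TS1∣ SHAPE SKETCH (documentation; NOT a skeleton, NOT registered, no stubs)

Crux `TwoVariableEulerSystemDivisibility` (stmt-BirchSwinnertonDyer-20728, route SignedBaseChange), line of record `Lines/ratlift.lean`
v5.2 (ef6a45324672b584).  Companion to the v5.2 section «HOW on CELL A …» — the same move for the SHARED PRE stub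
`stub_xAcTorsionSS_classDvd` (TS1∣{`p ∣ h_K`}; text byte-identical in `Lines/ratlift.lean` (20728) and the LEAD's `Lines/admdef.lean`
(20727)): Plan A of `STUB-IDEAS-stub_xAcTorsionSS_classDvd-g27.md` = TYPING WANT #2 (director-bsd REQUESTS 2026-08-29 16:09:58Z /
17:30:12Z) is Castella–Hsu–Kundu–Lee–Liu 2025 **Prop. 2.5** verbatim:

> [corpus:paper:arxiv-2308.10474 p0008 L17–L28] «The first claim in Conjecture 2.4 is now known under a mild hypothesis.
> Proposition 2.5. Assume (h0). Then Sel_q(K∞, W) is Λ-cotorsion.  Proof. In the p-ordinary case, this follows from [CGLS22,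
> Thm. 4.2.2] and [CGS23, Thm. 5.53]. … For supersingular primes p (and assuming a_p = 0 when p = 3), the result similarly follows
> from an adaptation of the argument in [CGLS22, Thm. 3.4.1] applied to (signed) Heegner point Kolyvagin system constructed in
> [CW24, Thm. A.4] (which is non-trivial by [CW24, Cor. 6.4] and in a similar relation to L_q^BDP as in the p-ordinary case by
> virtue of [CW24, Thm. 6.2]). …»

with the standing setting of §1–§2 [p0002 L55–L62: «(h0) E(K)[p] = 0»; p0006 L33–L37: «assume that the triple (E, K, p) satisfies
hypotheses (Heeg) and (spl)», `q ∈ {𝔭, 𝔭̄}`, `p > 2` good].  NO class-number, square-freeness or ramified-torsion hypothesis is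
printed.  Below, `hProp25` is the SHAPE a typer would give it in the object currency ALREADY AUDITED for this source (the tree's
`CastellaHsuKunduLeeLiu2025.thm71_cor72_exists_isCWBDPLFunction_charIdeal_map_le_rat`: `X_q := Sel_q(K∞, W)^∨ = AcSelmer.XAc (W⁄K) p κ 𝔮' ∅ γ`,
flag `CW24-53-orientation-L33`; Prop. 2.5 covers BOTH `q`, so the orientation of the pair `(𝔭, 𝔭̄)` is immaterial here and the shape quantifies
over an arbitrary ordered pair of distinct primes above `p`), with (h0) in the currency of `torsionBy_eq_bot_of_isImaginaryQuadratic`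
(`AddSubgroup.torsionBy (W.baseChange K).toAffine.Point (p : ℤ) = ⊥`) and the restrictions `5 ≤ p`, `a_p = 0` (the supersingular branch
the stub needs; WEAKER than print).  It is a section `variable` INCLUDED as an explicit hypothesis — nothing is defined or asserted in this
file; typing the source is a Literature task (TYPING WANT #2), not done here.

THE GLUE (kernel-checked, no `sorry`): `xAcTorsionSS_classDvd_of_prop25` — the byte-exact text of `stub_xAcTorsionSS_classDvd` follows from
`hProp25` by instantiation, (h0) being DISCHARGED from the stub's own binder `Surj` (`ρ̄_{E,p}` onto) via Gross 1991 §2 =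
`torsionBy_eq_bot_of_isImaginaryQuadratic` (`p ≠ 2` from `5 ≤ p`).  Hence: the day TYPING WANT #2 lands in this shape, TS1∣ is PURE-CITE in
BOTH skeletons (20728 `ratlift`, 20727 `admdef`) by one line each; until then TS1∣ stays PRE (CCSS18 Thm. 5.7 / `…XAcTorsion.xAcTorsionSS_of_CCSS18`).
The binder `p ∣ NumberField.classNumber K` of the stub is simply not used (Prop. 2.5 has no class-number hypothesis), so the same glue
also re-closes the `p ∤ h_K` case already closed by the refereed LV19 Thm 1.4 + CW24 §6 typing.
No summit statement, crux or stub is proved by this file; BSD is not proved. -/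

/- The line namespace repeats the problem name by design. -/
set_option linter.dupNamespace false
set_option autoImplicit false

noncomputable section

open scoped Classical
open Summit.BirchSwinnertonDyer.BirchSwinnertonDyer.Theses.SignedBaseChange
open Literature.NumberTheory.EllipticCurves

namespace Summit.BirchSwinnertonDyer.BirchSwinnertonDyer.Cruxes.TwoVariableEulerSystemDivisibility.Ratlift.TS1Shape

section Prop25

/- SHAPE (section hypothesis; nothing asserted): CHKLL25 Prop. 2.5, supersingular branch, in the audited `XAc` currency.
Binders: `W/ℚ` globally minimal elliptic of conductor `N`; `5 ≤ p` good with `a_p = 0`; `K` imaginary quadratic; (spl) `p` split,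
`𝔮 ≠ 𝔮'` the two primes above `p` (either order); (Heeg) every prime `ℓ ∣ N` split in `K`; (h0) `E(K)[p] = 0`; `κ` the anticyclotomic
`ℤ_p`-extension with topological generator `γ`.  Conclusion: `X = AcSelmer.XAc (W⁄K) p κ 𝔮' ∅ γ` is `Λ`-torsion.
[cite: CastellaEtAl2025, Prop. 2.5 (arXiv:2308.10474v2 p0008 L17–L28), (h0) (p0002 L62), §2 setting (p0006 L33–L37)]
[cite: CastellaWan2023, Thm. A.4, Cor. 6.4, Thm. 6.2] -/
variable (hProp25 :
  ∀ {p : ℕ} [Fact p.Prime] (W : WeierstrassCurve ℚ) [W.IsElliptic] [W.IsGloballyMinimal]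
    (K : Type) [Field K] [NumberField K] (𝔮 𝔮' : IsDedekindDomain.HeightOneSpectrum (NumberField.RingOfIntegers K))
    (κ : ZpExtension K p) (γ : Field.absoluteGaloisGroup K) [Fact (κ.IsTopGenerator γ)] (N : ℕ) [NeZero N],
    (N : ℤ) = W.conductorNorm ℤ → 5 ≤ p → W.HasGoodReductionAtPrime p → W.frobeniusTrace p = 0 →
    IsImaginaryQuadratic K → ((Ideal.span {(p : ℤ)}).primesOver (NumberField.RingOfIntegers K)).ncard = 2 →
      ((p : ℕ) : NumberField.RingOfIntegers K) ∈ 𝔮.asIdeal → ((p : ℕ) : NumberField.RingOfIntegers K) ∈ 𝔮'.asIdeal → 𝔮' ≠ 𝔮 →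
    (∀ ℓ : ℕ, ℓ.Prime → ℓ ∣ N → ((Ideal.span {(ℓ : ℤ)}).primesOver (NumberField.RingOfIntegers K)).ncard = 2) →
    AddSubgroup.torsionBy (W.baseChange K).toAffine.Point (p : ℤ) = ⊥ →
    κ.IsAnticyclotomic →
    Module.IsTorsion (IwasawaAlgebra p) (Castella2018.AcSelmer.XAc (W.baseChange K) p κ 𝔮' ∅ γ))

include hProp25 in
/-- **TS1∣ from the Prop. 2.5 shape (kernel glue, no `sorry`)**: the conclusion is the byte-exact text of the shared registered stub
`stub_xAcTorsionSS_classDvd` (of `Lines/ratlift.lean` on 20728 and `Lines/admdef.lean` on 20727).  (h0) is discharged from `Surj` by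
`torsionBy_eq_bot_of_isImaginaryQuadratic` (Gross 1991 §2); the binders `ι`, `(N, D_K) = 1`, `Odd D_K`, `D_K ≠ -3`, `κ₁`, `f`, the inputs and
`p ∣ h_K` are not used.  CONDITIONAL on the displayed shape hypothesis (to be discharged by a Literature typing of the printed Prop. 2.5; not by
this file). [cite: CastellaEtAl2025, Prop. 2.5 (arXiv:2308.10474v2 p0008 L17–L28)] [cite: GrossLMS1991, §2 (sentence after (2.2))] -/
theorem xAcTorsionSS_classDvd_of_prop25 :
    SignedTwoVariableInputs → Literature.NumberTheory.EllipticCurves.ModularForms.nonempty_modularParametrizationData → ∀ (W : WeierstrassCurve ℚ) [W.IsElliptic] [W.IsGloballyMinimal] (p : ℕ) [Fact p.Prime], 5 ≤ p → W.HasGoodReductionAtPrime p → W.frobeniusTrace p = 0 → Literature.NumberTheory.EllipticCurves.Rank1Residual.Surj W p → ∀ (K : Type) [Field K] [NumberField K] (ι : PadicAlgCl p ≃+* ℂ) (v vbar : IsDedekindDomain.HeightOneSpectrum (NumberField.RingOfIntegers K)) (κ₁ κ₂ : Literature.NumberTheory.EllipticCurves.ZpExtension K p) (γ₁ γ₂ :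 Field.absoluteGaloisGroup K) [Fact (Literature.NumberTheory.EllipticCurves.ZpExtension.IsTopGeneratorPair κ₁ κ₂ γ₁ γ₂)] [NeZero (NumberField.discr K).natAbs] (N : ℕ) [NeZero N] (f : CuspForm (CongruenceSubgroup.Gamma0 N) 2), Literature.NumberTheory.EllipticCurves.ModularForms.IsNewformOf W f → (N : ℤ) = W.conductorNorm ℤ → Literature.NumberTheory.EllipticCurves.IsImaginaryQuadratic K → ((Ideal.span {(p : ℤ)}).primesOver (NumberField.RingOfIntegers K)).ncard = 2 → ((p : ℕ) : NumberField.RingOfIntegers K) ∈ v.asIdeal → ((p : ℕ) : NumberField.RingOfIntegers K) ∈ vbar.asIdeal → vbar ≠ v → (∀ (w : NumberField.InfinitePlace K) (k : NumberField.RingOfIntegers K), k ∈ v.asIdeal ↔ ‖ι.symm (w.embedding (k : K))‖ < 1) → IsCoprime (N : ℤ) (NumberField.discr K) → (∀ ℓ : ℕ, ℓ.Prime → ℓ ∣ N → ((Ideal.span {(ℓ : ℤ)}).primesOver (NumberField.RingOfIntegers K)).ncard = 2) → Odd (NumberField.discr K) → NumberField.discr K ≠ -3 → κ₁.IsCyclotomic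 → κ₂.IsAnticyclotomic → p ∣ NumberField.classNumber K → (haveI : Fact (κ₂.IsTopGenerator γ₂) := ⟨Literature.NumberTheory.EllipticCurves.YanZhu2026.isTopGenerator_of_pair (κ₁ := κ₁) (γ₁ := γ₁)⟩; Module.IsTorsion (Literature.NumberTheory.EllipticCurves.IwasawaAlgebra p) (Literature.NumberTheory.EllipticCurves.Castella2018.AcSelmer.XAc (W.baseChange K) p κ₂ vbar ∅ γ₂)) := by
  intro _ _ W _ _ p _ hp hgood ha0 hs K _ _ ι v vbar κ₁ κ₂ γ₁ γ₂ _ _ N _ f _ hN hK hsplit hv hvbar hvv _ _ hHeeg _ _ _ hκ₂ _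
  haveI : Fact (κ₂.IsTopGenerator γ₂) := ⟨YanZhu2026.isTopGenerator_of_pair (κ₁ := κ₁) (γ₁ := γ₁)⟩
  have hprime : p.Prime := Fact.out
  have h0 : AddSubgroup.torsionBy (W.baseChange K).toAffine.Point (p : ℤ) = ⊥ :=
    torsionBy_eq_bot_of_isImaginaryQuadratic W K hK hprime (by omega) hs
  exact hProp25 W K v vbar κ₂ γ₂ N hN hp hgood ha0 hK hsplit hv hvbar hvv hHeeg h0 hκ₂

end Prop25

end Summit.BirchSwinnertonDyer.BirchSwinnertonDyer.Cruxes.TwoVariableEulerSystemDivisibility.Ratlift.TS1Shape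

end
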